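import Literature.AlgebraicGeometry.Resolution.CentreBlowupThm36Point
import HarnessLib

/-!
# [CP19] Theorem 3.6 (1) for point centres, the chart-variable clause: an increase of `ε` under a
# point blow-up kills `V` entirely (`ω(x) = ε(x)`), proved in the coordinate model

Topic: `Literature/AlgebraicGeometry/Resolution`.  Cell `pub-rosobs` (resolution observatory), unit
`pub-rosobs-carver-g25`; sequel of `CentreBlowupThm36Point.lean`, which proved [CP19, Thm. 3.6 (1)]
for the point centre `𝒴 = {x}` up to ONE residual clause: there, an increase `ε(x') > ε(x)` at the
point `b` of the chart `u = u_j` was shown to kill every `V`-witness `∂F_{p,Z}/∂U_t ≠ 0`, `t ∉ E`,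
EXCEPT possibly the chart variable `t = j` itself.  This file removes the exception.

* V. Cossart, O. Piltant, *Resolution of singularities of arithmetical threefolds*, J. Algebra **529**
  (2019) 268–535 = arXiv:1412.0868 [CossartPiltant2019], Theorem 3.6 (p. 35): "… If
  `ε(x') > ε(x)`, the following holds: (1) we have `i₀(m_S) = p`, `ε(y) = ε(x) = ω(x)`, `δ(y) ∈ ℕ`, …
  and `F_{p,Z} ∈ (k(x')[U₁,…,U_n])^p[{U_j}_{j ∈ J_E ∖ {j₂,…,j_{e'₀}}}]`" — for the point centre and a
  NON-exceptional chart variable `u = u_{j₁}`, `j₁ ∉ J_E`, the displayed ring contains no `U_{j₁}`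
  outside `p`-th powers: `∂F_{p,Z}/∂U_{j₁} = 0`.  With Definition 2.16 (p. 24: `ω(x) = ε(x) − 1`
  if `V(TF_{p,Z},E,m_S) ≠ 0`, `ω(x) = ε(x)` otherwise; here `G = 0`, so `TF_{p,Z} = F_{p,Z}`) and
  Proposition 2.16 (i) (p. 21: "`V(F_{p,Z},E,m_S) = 0 ⇔ F_{p,Z} ∈ S/m_S[U₁,…,U_e][U_{e+1}^p,…,U_n^p]`",
  `div(u₁⋯u_e) = E`) this is the clause "`ε(x) = ω(x)`": together with the non-exceptional
  witnesses `t ≠ j₁` treated in `CentreBlowupThm36Point.lean`, NO `U_t`, `t ∉ E`, occurs in `F_{p,Z}`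
  outside `p`-th powers when `ε` increases.

## What is proved (every field `K` of characteristic `p`, every finite index type `σ`)

For a point state `s = (F, r)`, a boundary `E`, `ord₀ F = o ≥ p`, a chart `j ∉ E` and a point `b`
of the exceptional divisor (`b_j = 0`), with `E' = newBoundary j b E`:

* `PointBlowup.epsilon_step_le_of_pderiv_chart_ne_zero` — if `∂F_o/∂y_j ≠ 0` (`F_o` the initial
  form) then `ε(E', x') ≤ ε(E, x)`;
* `PointBlowup.epsilon_step_le_of_vNonzero`, `PointBlowup.omega_eq_epsilon_of_epsilonIncreases` —
  hence `V(F,E) ≠ 0 ⟹` no increase of `ε` at ANY point of ANY chart, i.e. **`ε(x') > ε(x)` forces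
  `ω(x) = ε(x)`**: [CP19, Thm. 3.6 (1)] "`ε(y) = ε(x) = ω(x)`" for `𝒴 = {x}`, in the model, in full;
* `CentreBlowup.CState.not_epsilonIncreases_univ_of_vNonzero`,
  `CentreBlowup.CState.omega_eq_epsilon_of_epsilonIncreases_univ` and
  **`CentreBlowup.CState.epsilonIncreaseForcesFirstKindAt_univ`** — the atlas predicate
  `EpsilonIncreaseForcesFirstKindAt p univ j b s` of `CentreBlowupAdaptedOrder.lean` ([CP19, Thm. 3.6
  (1)] read at one blow-up of the closed point) HOLDS for every state, chart and point.

## Proof (Euler's identity modulo `p` on the first layer)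

Suppose `ε` increases.  By `CentreBlowupThm36Point.lean`, `p ∣ o` and every initial monomial `y^d`
(`|d| = o`) has `p ∣ d_i` at every `i ≠ j` outside `L := {i ∈ E : b_i ≠ 0}` (the exceptional
components lost at `x'`).  Hence `∑_{i ∈ L} d_i ≡ |d| − d_j ≡ −d_j (mod p)` for every initial
monomial: on the chart transform `P₀ = ∑_{|d|=o} c_d y^{d^}` of the initial form (`d^_j = o − p`,
`d^_i = d_i`) Euler's operator along `L` acts as `∑_{i∈L} y_i ∂_i P₀ = −g`, `g := ∑ d_j c_d y^{d^}`,
and `g ≠ 0` because `∂F_o/∂y_j ≠ 0`.  Translating to `b`,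
`∑_{i∈L} (y_i + b_i) ∂_i Q = −g(y + b)` for `Q = P₀(y + b)`, and since `∂_i` kills `p`-th power
monomials in characteristic `p`, `Q` may be replaced by its cleaning `R` — the `y_j^{o−p}`-layer of
the new residual polynomial `F'`.  Now every monomial of `∑ (y_i + b_i) ∂_i R` sits at most one degree
below a monomial of `R`, while the layer lemma of `PointBlowupMohBound.lean` (the factor
`∏_{i∈L}(y_i + b_i)^{H_i}` of `g(y + b)` is a unit) produces a monomial of `g(y + b)` of degree
`≤ (o − p) + ∑_{i ∈ E, b_i = 0} H_i + (o − 1 − ∑_{i∈E} H_i)`.  So `F'` has a monomial of degree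
`≤ |r'| + ε(E, x)` in the layer `y_j^{o−p}`, where `r' = (H|_E ∪ {o − p at j})|_{b = 0}` bounds the
new minimum exponents from below: `ε(E', x') ≤ ε(E, x)`, a contradiction.

## Scope

As in `CentreBlowupThm36Point.lean`: the model is [CP19]'s setting with `G = 0`, `E` a coordinate
divisor, any field `K` of characteristic `p` (the model's deletion of `p`-th power monomials is the
polyhedral preparation exactly over perfect `K`); hypotheses `ω(x) > 0`, **(E)** of the printed
theorem are not needed for these statements about the model's numbers.  Not treated: the clauses of
(1) on `(J')_E` (empty for a point centre), assertion (2) of Theorem 3.6 (`ι(x') ≤ ι(x)` …), and curve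
centres.
-/

open MvPolynomial Finset

open scoped BigOperators

namespace Literature.AlgebraicGeometry.Resolution

open Literature.AlgebraicGeometry.Resolution.Hauser2010
open Literature.AlgebraicGeometry.Resolution.HauserPerlega2019 (initialForm)

namespace PointBlowup

/-! ### 0. Private helpers (as in `CentreBlowupThm36Point.lean`) -/

section Helpers

variable {σ : Type*} {K : Type*} [Field K]

/-- evaluation of `bigHVec`. [folklore] -/
private theorem bigHVec_apply' [DecidableEq σ] (E : Finset σ) (F : MvPolynomial σ K) (i : σ) :
    bigHVec E F i = if i ∈ E then (bigH F i).toNat else 0 := by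
  unfold bigHVec
  rw [Finsupp.finsetSum_apply]
  by_cases hi : i ∈ E
  · rw [if_pos hi, Finset.sum_eq_single_of_mem i hi (fun j _ hji => by
      rw [Finsupp.single_apply, if_neg hji])]
    exact Finsupp.single_eq_same
  · rw [if_neg hi]
    exact Finset.sum_eq_zero fun j hj => by
      have hji : j ≠ i := fun h => hi (h ▸ hj)
      rw [Finsupp.single_apply, if_neg hji]

/-- `H_i ≤ d_i` for every monomial `y^d` of `F`. [folklore] -/
private theorem bigH_le' {F : MvPolynomial σ K} {d : σ →₀ ℕ} (hd : d ∈ F.support) (i : σ) :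
    bigH F i ≤ d i :=
  Finset.inf_le (f := fun d : σ →₀ ℕ => ((d i : ℕ) : ℕ∞)) hd

/-- For `F ≠ 0`, `H_i` is finite. [folklore] -/
private theorem bigH_eq_toNat' {F : MvPolynomial σ K} (hF : F ≠ 0) (i : σ) :
    bigH F i = (((bigH F i).toNat : ℕ) : ℕ∞) := by
  obtain ⟨d, -, h⟩ := Finset.exists_mem_eq_inf F.support (MvPolynomial.support_nonempty.mpr hF)
    (fun d : σ →₀ ℕ => ((d i : ℕ) : ℕ∞))
  rw [show bigH F i = ((d i : ℕ) : ℕ∞) from h]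
  rfl

/-- For `F ≠ 0`, `ord₀ F` is finite. [folklore] -/
private theorem exists_ordZero_eq' {F : MvPolynomial σ K} (hF : F ≠ 0) : ∃ o : ℕ, ordZero F = o := by
  have hne : ordZero F ≠ ⊤ := by
    unfold ordZero
    rw [Ne, MvPowerSeries.order_eq_top_iff, MvPolynomial.coe_eq_zero_iff]
    exact hF
  exact ⟨(ordZero F).toNat, (ENat.coe_toNat hne).symm⟩

/-- A finite order means a non-zero polynomial. [folklore] -/
private theorem ne_zero_of_ordZero_eq' {F : MvPolynomial σ K} {o : ℕ} (ho : ordZero F = o) : F ≠ 0 := by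
  intro h
  rw [h, ordZero_zero] at ho
  exact ENat.top_ne_coe _ ho

/-- `y^{H|_E} ∣ F` monomialwise. [folklore] -/
private theorem bigHVec_le' [DecidableEq σ] (E : Finset σ) (F : MvPolynomial σ K) :
    ∀ d ∈ F.support, bigHVec E F ≤ d := by
  intro d hd
  have hF : F ≠ 0 := MvPolynomial.ne_zero_iff.mpr ⟨d, MvPolynomial.mem_support_iff.mp hd⟩
  rw [Finsupp.le_def]
  intro i
  rw [bigHVec_apply']
  split_ifs with hi
  · have h := bigH_le' hd i
    rw [bigH_eq_toNat' hF] at h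
    exact_mod_cast h
  · exact Nat.zero_le _

/-- `Σ_{i ∈ E} H_i = |H|_E|` for `F ≠ 0`. [folklore] -/
private theorem sum_bigH_eq' [DecidableEq σ] {F : MvPolynomial σ K} (hF : F ≠ 0) (E : Finset σ) :
    ∑ j ∈ E, bigH F j = (((bigHVec E F).degree : ℕ) : ℕ∞) := by
  unfold bigHVec
  rw [map_sum, Nat.cast_sum]
  exact Finset.sum_congr rfl fun j _ => by
    rw [Finsupp.degree_single]
    exact bigH_eq_toNat' hF j

/-- `ε(E, x)` is the shade of the auxiliary state `(F, H|_E)`. [folklore] -/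
private theorem epsilon_eq_shade' [DecidableEq σ] (E : Finset σ) (s : State σ K) (hF : s.F ≠ 0) :
    epsilon E s = (⟨s.F, bigHVec E s.F⟩ : State σ K).shade := by
  show ordZero s.F - ∑ j ∈ E, bigH s.F j = ordZero s.F - (((bigHVec E s.F).degree : ℕ) : ℕ∞)
  rw [sum_bigH_eq' hF]

/-- After the step, the new multiplicity record of the auxiliary state is dominated by the new
minimum exponents on the new boundary, so its shade dominates `ε(E', x')`. [folklore] -/
private theorem epsilon_step_le_shade_step' [Fintype σ] [DecidableEq σ] [DecidableEq K] (q : ℕ)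
    (j : σ) (b : σ → K) (hbj : b j = 0) (s : State σ K) (E : Finset σ) {o : ℕ}
    (ho : ordZero s.F = o) :
    epsilon (newBoundary j b E) (step q j b s) ≤ (step q j b ⟨s.F, bigHVec E s.F⟩).shade := by
  set t : State σ K := ⟨s.F, bigHVec E s.F⟩ with ht
  have hF' : (step q j b t).F = (step q j b s).F := rfl
  have hr : ∀ d ∈ t.F.support, t.r ≤ d := bigHVec_le' E s.F
  have hρ : ∀ e ∈ (step q j b t).F.support, (step q j b t).r ≤ e :=
    newMult_le_of_mem_support_step q j b hbj t ho hr
  have hρeq : (step q j b t).r = (t.r.update j (o - q)).filter (fun i => b i = 0) :=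
    newMult_eq q j b hbj t ho
  have hsub : ∀ i, (step q j b t).r i ≠ 0 → i ∈ newBoundary j b E := by
    intro i hi
    rw [hρeq, Finsupp.filter_apply] at hi
    unfold newBoundary
    rw [mem_insert, mem_filter]
    by_cases hij : i = j
    · exact Or.inl hij
    · right
      split_ifs at hi with hb
      · rw [Finsupp.update_apply, if_neg hij] at hi
        have hiE : i ∈ E := by
          by_contra hiE
          apply hi
          show bigHVec E s.F i = 0
          rw [bigHVec_apply', if_neg hiE]
        exact ⟨hiE, hij, hb⟩
      · exact absurd rfl hi
  have h1 : (((step q j b t).r.degree : ℕ) : ℕ∞) ≤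
      ∑ i ∈ newBoundary j b E, bigH (step q j b s).F i :=
    calc (((step q j b t).r.degree : ℕ) : ℕ∞)
        = ∑ i ∈ (step q j b t).r.support, (((step q j b t).r i : ℕ) : ℕ∞) := by
          rw [Finsupp.degree_apply, Nat.cast_sum]
      _ ≤ ∑ i ∈ newBoundary j b E, (((step q j b t).r i : ℕ) : ℕ∞) :=
          Finset.sum_le_sum_of_subset_of_nonneg
            (fun i hi => hsub i (Finsupp.mem_support_iff.mp hi)) (fun _ _ _ => zero_le)
      _ ≤ ∑ i ∈ newBoundary j b E, bigH (step q j b s).F i :=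
          Finset.sum_le_sum fun i _ =>
            Finset.le_inf fun e he => by
              exact_mod_cast Finsupp.le_def.mp (hρ e (hF' ▸ he)) i
  show ordZero (step q j b s).F - ∑ i ∈ newBoundary j b E, bigH (step q j b s).F i ≤
    ordZero (step q j b t).F - (((step q j b t).r.degree : ℕ) : ℕ∞)
  rw [hF']
  exact tsub_le_tsub_left h1 _

end Helpers

/-! ### 1. Private helpers for the Euler-operator argument -/

section Euler

variable {σ : Type*} {K : Type*} [Field K]

/-- `y_i ∂_i (c y^e) = e_i c y^e`. [folklore] -/
private theorem X_mul_pderiv_monomial' (i : σ) (e : σ →₀ ℕ) (c : K) :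
    X i * pderiv i (monomial e c) = monomial e (((e i : ℕ) : K) * c) := by
  rw [X_mul_pderiv_monomial, ← Nat.cast_smul_eq_nsmul K, smul_monomial, smul_eq_mul]

/-- In characteristic `p`, partial derivatives do not see `p`-th power monomials. [folklore] -/
private theorem pderiv_deletePthPowers' [DecidableEq σ] (p : ℕ) [CharP K p] (i : σ)
    (Q : MvPolynomial σ K) : pderiv i (deletePthPowers p Q) = pderiv i Q := by
  ext m
  rw [coeff_pderiv, coeff_pderiv, coeff_deletePthPowers]
  split_ifs with h
  · have hdvd : p ∣ m i + 1 := by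
      have := (isPthPowerExponent_iff p _).mp h i
      rwa [Finsupp.add_apply, Finsupp.single_eq_same] at this
    have hzero : ((m i : K) + 1) = 0 := by
      rw [← Nat.cast_succ, CharP.cast_eq_zero_iff K p]
      exact hdvd
    rw [hzero, mul_zero, mul_zero]
  · rfl

/-- Every monomial of `∑_{i∈L} (y_i + b_i) ∂_i R` lies at most one degree below a monomial of `R`.
[folklore] -/
private theorem exists_support_of_mem_support_euler' [Fintype σ] [DecidableEq σ] (L : Finset σ)
    (b : σ → K)
    (R : MvPolynomial σ K) {e' : σ →₀ ℕ}
    (he' : e' ∈ (∑ i ∈ L, (X i + C (b i)) * pderiv i R).support) :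
    ∃ e ∈ R.support, e.degree ≤ e'.degree + 1 := by
  rw [MvPolynomial.mem_support_iff, coeff_sum] at he'
  obtain ⟨i, -, hi⟩ := Finset.exists_ne_zero_of_sum_ne_zero he'
  rw [add_mul, coeff_add, coeff_X_mul', coeff_C_mul] at hi
  by_cases hc : coeff e' (pderiv i R) = 0
  · rw [hc, mul_zero, add_zero] at hi
    split_ifs at hi with hmem
    · rw [coeff_pderiv] at hi
      refine ⟨e' - Finsupp.single i 1 + Finsupp.single i 1,
        MvPolynomial.mem_support_iff.mpr (left_ne_zero_of_mul hi), ?_⟩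
      rw [map_add, Finsupp.degree_single]
      exact Nat.add_le_add_right (degree_le_degree_of_le tsub_le_self) 1
    · exact absurd rfl hi
  · rw [coeff_pderiv] at hc
    exact ⟨e' + Finsupp.single i 1, MvPolynomial.mem_support_iff.mpr (left_ne_zero_of_mul hc),
      by rw [map_add, Finsupp.degree_single]⟩

/-- Euler's identity modulo `p`: if `p ∣ |d|` and `p ∣ d_i` off `L ∪ {j}` then
`∑_{i∈L} d_i = −d_j` in `K`. [folklore] -/
private theorem euler_sum' [Fintype σ] [DecidableEq σ] (p : ℕ) [CharP K p] (j : σ) (L : Finset σ)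
    (hjL : j ∉ L) {d : σ →₀ ℕ} (hdeg : p ∣ d.degree) (hdiv : ∀ i, i ≠ j → i ∉ L → p ∣ d i) :
    ∑ i ∈ L, ((d i : ℕ) : K) = -((d j : ℕ) : K) := by
  have h0 : ((d.degree : ℕ) : K) = 0 := (CharP.cast_eq_zero_iff K p _).mpr hdeg
  rw [degree_eq_add_sum_erase j d, Nat.cast_add, Nat.cast_sum,
    ← Finset.sum_filter_add_sum_filter_not (univ.erase j) (fun i => i ∈ L)] at h0
  have h1 : (univ.erase j).filter (fun i => i ∈ L) = L := by
    ext i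
    simp only [Finset.mem_filter, Finset.mem_erase, Finset.mem_univ, and_true]
    exact ⟨fun h => h.2, fun h => ⟨fun hij => hjL (hij ▸ h), h⟩⟩
  have h2 : ∑ i ∈ (univ.erase j).filter (fun i => ¬ i ∈ L), ((d i : ℕ) : K) = 0 :=
    Finset.sum_eq_zero fun i hi => by
      rw [Finset.mem_filter, Finset.mem_erase] at hi
      exact (CharP.cast_eq_zero_iff K p _).mpr (hdiv i hi.1.1 hi.2)
  rw [h1, h2, add_zero] at h0
  exact eq_neg_of_add_eq_zero_right h0

/-- A monomial of the cleaned first layer (`y_j`-exponent `o − q`) of the translated chart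
transform is a monomial of the new residual polynomial: the other layers sit at `y_j`-exponents
`≥ o + 1 − q`. [folklore] -/
private theorem mem_support_step_of_layer' [Fintype σ] [DecidableEq σ] [DecidableEq K] (q : ℕ)
    (j : σ) (b : σ → K) (hbj : b j = 0) (s : State σ K) {o : ℕ} (ho : ordZero s.F = o)
    (hqo : q ≤ o) {e : σ →₀ ℕ} (hej : e j = o - q)
    (he : e ∈ (deletePthPowers q (translate b (∑ d ∈ s.F.support with d.degree = o,
        monomial (chartExponent q j d) (coeff d s.F)))).support) :
    e ∈ (step q j b s).F.support := by
  rw [MvPolynomial.mem_support_iff] at he ⊢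
  have hF : (step q j b s).F =
      deletePthPowers q (translate b (∑ d ∈ s.F.support with d.degree = o,
        monomial (chartExponent q j d) (coeff d s.F))) +
      deletePthPowers q (translate b (∑ d ∈ s.F.support with ¬ d.degree = o,
        monomial (chartExponent q j d) (coeff d s.F))) := by
    show deletePthPowers q (pointTransform q j b s) = _
    unfold pointTransform chartTransform translate
    rw [← deletePthPowers_add, ← map_add, Finset.sum_filter_add_sum_filter_not]
  rw [hF, coeff_add]
  have hzero : coeff e (deletePthPowers q (translate b (∑ d ∈ s.F.support with ¬ d.degree = o,
      monomial (chartExponent q j d) (coeff d s.F)))) = 0 := by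
    rw [coeff_deletePthPowers]
    split_ifs with hP
    · rfl
    unfold translate
    rw [map_sum, coeff_sum]
    refine Finset.sum_eq_zero fun d hd => ?_
    rw [Finset.mem_filter] at hd
    by_contra hne
    have h1 := apply_eq_of_coeff_translate_monomial_ne_zero b hbj hne
    rw [chartExponent_apply, if_pos rfl] at h1
    have h2 := le_degree_of_ordZero_eq s ho d hd.1
    omega
  rw [hzero, add_zero]
  exact he

end Euler

/-! ### 2. The chart-variable clause -/

section Main

variable {σ : Type*} {K : Type*} [Field K] [Fintype σ] [DecidableEq σ] [DecidableEq K]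
variable (p : ℕ) [hp : Fact p.Prime] [CharP K p]

/-- **No increase of `ε` at a chart whose variable is a `V`-witness.** For a residual polynomial
`F` of order `o ≥ p`, a boundary `E`, a NON-exceptional chart variable `y_j` (`j ∉ E`) with
`∂F_o/∂y_j ≠ 0` and any point `b` of the exceptional divisor of the chart:
`ε(E', x') ≤ ε(E, x)` — the chart-variable clause of [CP19, Thm. 3.6 (1)]
("`F_{p,Z} ∈ (k(x')[U₁,…,U_n])^p[{U_j}_{j ∈ J_E ∖ {j₂,…,j_{e'₀}}}]`" with `u = u_{j₁}`, `j₁ ∉ J_E`),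
for the point centre. [cite: CossartPiltant2019, Thm. 3.6 (1) (p. 35)] -/
theorem epsilon_step_le_of_pderiv_chart_ne_zero (j : σ) (b : σ → K) (hbj : b j = 0)
    (s : State σ K) (E : Finset σ) (hjE : j ∉ E) {o : ℕ} (ho : ordZero s.F = o) (hpo : p ≤ o)
    (hpd : pderiv j (initialForm s.F) ≠ 0) :
    epsilon (newBoundary j b E) (step p j b s) ≤ epsilon E s := by
  by_contra hlt
  rw [not_le] at hlt
  -- (R1) `p ∣ o` and (R2) exponents `≡ 0 (mod p)` off `L ∪ {j}`, from the previous file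
  have hR1 : p ∣ o := by
    by_contra hnd
    exact absurd (epsilon_step_le_of_not_dvd p j b hbj s E ho hpo hnd) (not_le.mpr hlt)
  set L : Finset σ := E.filter (fun i => b i ≠ 0) with hL
  have hjL : j ∉ L := fun h => hjE (Finset.mem_filter.mp h).1
  have hR2 : ∀ d ∈ s.F.support, d.degree = o → ∀ i, i ≠ j → i ∉ L → p ∣ d i := by
    intro d hd hdeg i hij hiL
    by_contra hnd
    have hfix : i ∉ E ∨ b i = 0 := by
      by_cases hiE : i ∈ E
      · right
        by_contra hb
        exact hiL (Finset.mem_filter.mpr ⟨hiE, hb⟩)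
      · exact Or.inl hiE
    exact absurd (epsilon_step_le_of_not_dvd_apply p j b hbj s E ho hpo hij hfix hd hdeg hnd)
      (not_le.mpr hlt)
  obtain ⟨d₀, hd₀, hd₀deg, hd₀j⟩ := exists_not_dvd_of_pderiv_initialForm_ne_zero p ho hpd
  -- the chart transform of the initial form, its `j`-weighted version, the cleaned first layer
  set T : Finset (σ →₀ ℕ) := s.F.support.filter (fun d => d.degree = o) with hT
  set P₀ : MvPolynomial σ K := ∑ d ∈ T, monomial (chartExponent p j d) (coeff d s.F) with hP₀
  set g : MvPolynomial σ K :=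
    ∑ d ∈ T, monomial (chartExponent p j d) (((d j : ℕ) : K) * coeff d s.F) with hg
  set R : MvPolynomial σ K := deletePthPowers p (translate b P₀) with hR
  -- Euler's identity modulo `p`: `∑_{i∈L} y_i ∂_i P₀ = -g`
  have hA : ∑ i ∈ L, X i * pderiv i P₀ = -g := by
    have h1 : ∀ i ∈ L, X i * pderiv i P₀ =
        ∑ d ∈ T, monomial (chartExponent p j d) (((d i : ℕ) : K) * coeff d s.F) := by
      intro i hi
      have hij : i ≠ j := fun h => hjL (h ▸ hi)
      rw [hP₀, map_sum (pderiv i), Finset.mul_sum]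
      refine Finset.sum_congr rfl fun d _ => ?_
      rw [X_mul_pderiv_monomial', chartExponent_apply, if_neg hij]
    rw [Finset.sum_congr rfl h1, Finset.sum_comm, hg, ← Finset.sum_neg_distrib]
    refine Finset.sum_congr rfl fun d hd => ?_
    have hdF : d ∈ s.F.support := (Finset.mem_filter.mp hd).1
    have hddeg : d.degree = o := (Finset.mem_filter.mp hd).2
    rw [← map_sum (monomial (chartExponent p j d)), ← Finset.sum_mul,
      euler_sum' p j L hjL (by rw [hddeg]; exact hR1) (hR2 d hdF hddeg), neg_mul, map_neg]
  -- translate and clean: `g(y + b) = -∑_{i∈L} (y_i + b_i) ∂_i R`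
  have hB : translate b g = -∑ i ∈ L, (X i + C (b i)) * pderiv i R := by
    have hg' : g = -∑ i ∈ L, X i * pderiv i P₀ := by rw [hA, neg_neg]
    rw [hg']
    unfold translate
    rw [map_neg, map_sum]
    congr 1
    refine Finset.sum_congr rfl fun i _ => ?_
    simp only [map_mul, aeval_X]
    congr 1
    show translate b (pderiv i P₀) = pderiv i (deletePthPowers p (translate b P₀))
    rw [pderiv_deletePthPowers', pderiv_translate]
  -- the auxiliary multiplicity records
  set t : State σ K := ⟨s.F, bigHVec E s.F⟩ with ht
  set ρ : σ →₀ ℕ := (bigHVec E s.F).update j (o - p) with hρ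
  have hρj : ρ j = o - p := by rw [hρ, Finsupp.update_apply, if_pos rfl]
  have hρi : ∀ i, i ≠ j → ρ i = bigHVec E s.F i := fun i hi => by
    rw [hρ, Finsupp.update_apply, if_neg hi]
  have hHj : bigHVec E s.F j = 0 := by rw [bigHVec_apply', if_neg hjE]
  have hdegH : (bigHVec E s.F).degree + 1 ≤ o := by
    have hle : bigHVec E s.F + Finsupp.single j 1 ≤ d₀ := by
      rw [Finsupp.le_def]
      intro i
      rw [Finsupp.add_apply, Finsupp.single_apply]
      by_cases hij : j = i
      · subst hij
        rw [hHj, zero_add, if_pos rfl]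
        exact Nat.one_le_iff_ne_zero.mpr (fun h => hd₀j (h ▸ dvd_zero p))
      · rw [if_neg hij, add_zero]
        exact Finsupp.le_def.mp (bigHVec_le' E s.F d₀ hd₀) i
    have := degree_le_degree_of_le hle
    rw [map_add, Finsupp.degree_single, hd₀deg] at this
    exact this
  have hρdeg : ρ.degree = (bigHVec E s.F).degree + (o - p) := by
    have := degree_update_add (bigHVec E s.F) j (o - p)
    rw [hHj, add_zero] at this
    rw [hρ]
    exact this
  -- the layer lemma applied to `g`
  have hsuppg : ∀ e ∈ g.support,
      ∃ d ∈ T, ((d j : ℕ) : K) * coeff d s.F ≠ 0 ∧ chartExponent p j d = e :=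
    fun e he => exists_of_mem_support_sum_monomial T _ _ he
  have hρle : ∀ e ∈ g.support, ρ ≤ e := by
    intro e he
    obtain ⟨d, hd, -, rfl⟩ := hsuppg e he
    have hdF : d ∈ s.F.support := (Finset.mem_filter.mp hd).1
    have hddeg : d.degree = o := (Finset.mem_filter.mp hd).2
    rw [Finsupp.le_def]
    intro i
    rw [chartExponent_apply]
    by_cases hij : i = j
    · rw [if_pos hij, hij, hρj, hddeg]
    · rw [if_neg hij, hρi i hij]
      exact Finsupp.le_def.mp (bigHVec_le' E s.F d hdF) i
  have hD : ∀ e ∈ g.support, e j = ρ j →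
      e.degree ≤ ρ.degree + (o - 1 - (bigHVec E s.F).degree) := by
    intro e he _
    obtain ⟨d, hd, hne, rfl⟩ := hsuppg e he
    have hddeg : d.degree = o := (Finset.mem_filter.mp hd).2
    have hdj : 1 ≤ d j := by
      rw [Nat.one_le_iff_ne_zero]
      intro h0
      apply hne
      rw [h0, Nat.cast_zero, zero_mul]
    rw [degree_chartExponent, hρdeg, hddeg]
    omega
  have hlay : ∃ e ∈ g.support, e j = ρ j := by
    refine ⟨chartExponent p j d₀, ?_, by rw [chartExponent_apply, if_pos rfl, hρj, hd₀deg]⟩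
    rw [MvPolynomial.mem_support_iff, hg, coeff_sum_monomial_of_injOn T
      (fun d => chartExponent p j d) (fun d => ((d j : ℕ) : K) * coeff d s.F)
      (Finset.mem_filter.mpr ⟨hd₀, hd₀deg⟩) ?_]
    · exact mul_ne_zero (fun h => hd₀j ((CharP.cast_eq_zero_iff K p _).mp h))
        (MvPolynomial.mem_support_iff.mp hd₀)
    · intro d hd _ heq
      have hddeg : d.degree = o := (Finset.mem_filter.mp hd).2
      exact chartExponent_injective (by rw [hddeg]; exact hpo) (by rw [hd₀deg]; exact hpo) heq
  obtain ⟨E', hE', -, hE'deg⟩ :=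
    exists_mem_support_translate_layer b hbj g ρ hρle (o - 1 - (bigHVec E s.F).degree) hD hlay
  -- `E'` is a monomial of the Euler operator applied to `R`; pull it back to `R`
  have hE'2 : E' ∈ (∑ i ∈ L, (X i + C (b i)) * pderiv i R).support := by
    rw [MvPolynomial.mem_support_iff] at hE' ⊢
    rw [hB, coeff_neg] at hE'
    exact neg_ne_zero.mp hE'
  obtain ⟨e, he, hedeg⟩ := exists_support_of_mem_support_euler' L b R hE'2
  have hej : e j = o - p := by
    have he' : coeff e (translate b P₀) ≠ 0 := by
      have := MvPolynomial.mem_support_iff.mp he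
      rw [hR, coeff_deletePthPowers] at this
      split_ifs at this with hh
      · exact absurd rfl this
      · exact this
    unfold translate at he'
    rw [hP₀, map_sum, coeff_sum] at he'
    obtain ⟨d, hd, hne⟩ := Finset.exists_ne_zero_of_sum_ne_zero he'
    have h1 := apply_eq_of_coeff_translate_monomial_ne_zero b hbj hne
    rw [chartExponent_apply, if_pos rfl, (Finset.mem_filter.mp hd).2] at h1
    exact h1
  have hestep : e ∈ (step p j b s).F.support :=
    mem_support_step_of_layer' p j b hbj s ho hpo hej (by rw [hR, hP₀, hT] at he; exact he)
  -- the bound on `ε(E', x')` through the auxiliary state `t = (F, H|_E)`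
  have hr' : (step p j b t).r = ρ.filter (fun i => b i = 0) := by
    rw [hρ]
    exact newMult_eq p j b hbj t ho
  have hshade : (step p j b t).shade ≤ ((o - (bigHVec E s.F).degree : ℕ) : ℕ∞) := by
    refine shade_le_of_mem_support (step p j b t) (E := e) hestep ?_
    rw [hr']
    omega
  have hF : s.F ≠ 0 := ne_zero_of_ordZero_eq' ho
  have hεs : epsilon E s = ((o - (bigHVec E s.F).degree : ℕ) : ℕ∞) := by
    rw [epsilon_eq_shade' E s hF]
    exact shade_eq_of_ordZero_eq t ho
  have hfin := lt_of_lt_of_le hlt (le_trans (epsilon_step_le_shade_step' p j b hbj s E ho) hshade)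
  rw [hεs] at hfin
  exact lt_irrefl _ hfin

/-- **`V ≠ 0` forbids any increase of `ε` under a point blow-up** — [CP19, Thm. 3.6 (1)] for the
point centre: "if `ε(x') > ε(x)` … `ε(y) = ε(x) = ω(x)`", i.e. `V(F_{p,Z},E,m_S) = 0`
(contrapositive), at every point `x'` of every chart. [cite: CossartPiltant2019, Thm. 3.6 (1) (p. 35)] -/
theorem epsilon_step_le_of_vNonzero (j : σ) (b : σ → K) (hbj : b j = 0) (s : State σ K)
    (E : Finset σ) {o : ℕ} (ho : ordZero s.F = o) (hpo : p ≤ o) (hV : VNonzero E s.F) :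
    epsilon (newBoundary j b E) (step p j b s) ≤ epsilon E s := by
  obtain ⟨t, htE, hpd⟩ := hV
  by_cases htj : t = j
  · subst htj
    exact epsilon_step_le_of_pderiv_chart_ne_zero p t b hbj s E htE ho hpo hpd
  · exact epsilon_step_le_of_pderiv_ne_zero p j b hbj s E ho hpo htj (Or.inl htE) hpd

/-- **An increase of `ε` under a point blow-up forces `ω(x) = ε(x)`** ([CP19, Thm. 3.6 (1)]
"`ε(y) = ε(x) = ω(x)`" for `𝒴 = {x}`, proved in the model).
[cite: CossartPiltant2019, Thm. 3.6 (1) (p. 35)] -/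
theorem omega_eq_epsilon_of_epsilonIncreases (j : σ) (b : σ → K) (hbj : b j = 0) (s : State σ K)
    (E : Finset σ) {o : ℕ} (ho : ordZero s.F = o) (hpo : p ≤ o)
    (hinc : epsilon E s < epsilon (newBoundary j b E) (step p j b s)) : omega E s = epsilon E s := by
  unfold omega
  rw [if_neg]
  intro hV
  exact absurd (epsilon_step_le_of_vNonzero p j b hbj s E ho hpo hV) (not_le.mpr hinc)

end Main

end PointBlowup

/-! ### 3. The centre-blow-up model at `S = univ`: the atlas predicate holds -/

namespace CentreBlowup

namespace CState

section Univ

variable {σ : Type*} {K : Type*} [Field K] [Fintype σ] [DecidableEq σ] [DecidableEq K]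
variable (p : ℕ) [hp : Fact p.Prime] [CharP K p]

omit hp [CharP K p] in
/-- The blow-up of the zero polynomial has `ε = 0` (`E' ∋ j` is non-empty and `H_j(0) = ⊤`). [folklore] -/
private theorem epsilon_step_univ_of_F_eq_zero' (q : ℕ) (j : σ) (b : σ → K) (s : CState σ K)
    (hF : s.F = 0) : (step q Finset.univ j b s).epsilon = 0 := by
  have h1 : (step q Finset.univ j b s).F = 0 := by
    show deletePthPowers q (PointBlowup.translate b (chartTransform q Finset.univ j s.F)) = 0
    unfold chartTransform PointBlowup.translate
    rw [hF, MvPolynomial.support_zero, Finset.sum_empty, map_zero, deletePthPowers_zero]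
  have hj : j ∈ (step q Finset.univ j b s).exc := by
    show j ∈ newExc j b s
    exact Finset.mem_insert_self _ _
  have htop : PointBlowup.bigH (0 : MvPolynomial σ K) j = ⊤ := by
    unfold PointBlowup.bigH
    rw [MvPolynomial.support_zero, Finset.inf_empty]
  have h2 : ∑ i ∈ (step q Finset.univ j b s).exc, PointBlowup.bigH (0 : MvPolynomial σ K) i = ⊤ := by
    refine eq_top_iff.mpr ?_
    calc (⊤ : ℕ∞) = PointBlowup.bigH (0 : MvPolynomial σ K) j := htop.symm
      _ ≤ ∑ i ∈ (step q Finset.univ j b s).exc, PointBlowup.bigH (0 : MvPolynomial σ K) i :=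
          Finset.single_le_sum (f := fun i => PointBlowup.bigH (0 : MvPolynomial σ K) i)
            (fun _ _ => zero_le) hj
  rw [epsilon_eq, h1, h2]
  exact ENat.sub_top _

omit hp [CharP K p] in
/-- An increase of `ε` can only happen for `F ≠ 0`. [folklore] -/
private theorem F_ne_zero_of_epsilonIncreases' {q : ℕ} {j : σ} {b : σ → K} {s : CState σ K}
    (hinc : EpsilonIncreases q Finset.univ j b s) : s.F ≠ 0 := by
  intro hF
  unfold EpsilonIncreases at hinc
  rw [epsilon_step_univ_of_F_eq_zero' q j b s hF] at hinc
  exact not_lt_of_ge zero_le hinc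

omit [DecidableEq K] hp [CharP K p] in
/-- A permissible point centre is `p`-fold. [cite: CossartPiltant2019, Def. 3.1–3.2 (p. 31–32)] -/
private theorem le_ordZero_of_isPermissibleCentre_univ' {q : ℕ} {s : CState σ K}
    (h : IsPermissibleCentre q Finset.univ s) : (q : ℕ∞) ≤ ordZero s.F := by
  rcases h with h1 | h2
  · have := h1.1.2
    rwa [ordAlong_univ] at this
  · have := h2.1.2
    rwa [ordAlong_univ] at this

/-- **`V(F_{p,Z},E,m_S) ≠ 0` forbids an increase of `ε` under the blow-up of the closed point**, at
every point of every chart ([CP19, Thm. 3.6 (1)] for `𝒴 = {x}`).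
[cite: CossartPiltant2019, Thm. 3.6 (1) (p. 35)] -/
theorem not_epsilonIncreases_univ_of_vNonzero (j : σ) (b : σ → K) (hbj : b j = 0)
    (s : CState σ K) (hord : (p : ℕ∞) ≤ ordZero s.F) (hV : PointBlowup.VNonzero s.exc s.F) :
    ¬ EpsilonIncreases p Finset.univ j b s := by
  intro hinc
  have hF : s.F ≠ 0 := F_ne_zero_of_epsilonIncreases' hinc
  obtain ⟨o, ho⟩ := PointBlowup.exists_ordZero_eq' hF
  have hpo : p ≤ o := by rw [ho] at hord; exact_mod_cast hord
  unfold EpsilonIncreases at hinc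
  rw [epsilon_step_univ] at hinc
  exact absurd (PointBlowup.epsilon_step_le_of_vNonzero p j b hbj s.toState s.exc ho hpo hV)
    (not_le.mpr hinc)

/-- **An increase of `ε` under the blow-up of the closed point forces `ω(x) = ε(x)`**
([CP19, Thm. 3.6 (1)] "`ε(y) = ε(x) = ω(x)`" for `𝒴 = {x}`, proved in the model).
[cite: CossartPiltant2019, Thm. 3.6 (1) (p. 35)] -/
theorem omega_eq_epsilon_of_epsilonIncreases_univ (j : σ) (b : σ → K) (hbj : b j = 0)
    (s : CState σ K) (hord : (p : ℕ∞) ≤ ordZero s.F) (hinc : EpsilonIncreases p Finset.univ j b s) :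
    s.omega = s.epsilon :=
  omega_eq_of_not_vNonzero s fun hV => not_epsilonIncreases_univ_of_vNonzero p j b hbj s hord hV hinc

/-- **The atlas predicate `EpsilonIncreaseForcesFirstKindAt p univ j b s` holds for every state,
chart and point**: [CP19, Thm. 3.6 (1)] ("if `ε(x') > ε(x)` then `ε(y) = ε(x) = ω(x)`") read at one
blow-up of the closed point, proved in the model. [cite: CossartPiltant2019, Thm. 3.6 (1) (p. 35)] -/
theorem epsilonIncreaseForcesFirstKindAt_univ (j : σ) (b : σ → K) (s : CState σ K) :
    EpsilonIncreaseForcesFirstKindAt p Finset.univ j b s := by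
  intro _ hbj _ hperm _ _ _ hinc
  exact ⟨epsilonAlong_univ s, omega_eq_epsilon_of_epsilonIncreases_univ p j b hbj s
    (le_ordZero_of_isPermissibleCentre_univ' hperm) hinc⟩

end Univ

end CState

end CentreBlowup

end Literature.AlgebraicGeometry.Resolution
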